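import Summits.QuantumFields.YangMills.Theorems.BalabanUVNodesN12RootTransporterBj
import Literature.MathematicalPhysics.QuantumFieldTheory.Balaban1983to89.Node00.MultiScaleFibreChartB
import HarnessLib

/-!
# BalabanUVNodes ∕ N12 — THE ROOT-TRANSPORTER LETTER `hT` AT THE RECORD's `𝐁_k(Z)`, inhabited from the (G-c) root chains: for every fine bond inside `Ω₁(Z)` a fine word from `root b₋` to — **BOND-DATUM EDITION** (`…N12RootTransporterBjB`, USED DECLARATIONS ONLY)

The print-datum ([Balaban1984PropagatorsII] (2.3)) (γ) twin of `Summits/…/Theorems/BalabanUVNodesN12RootTransporterBj.lean`: the declarations of the parent whose STATEMENT reads the determining datum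
(`transporter_of_links`) and which N12's junction of record v14ᴸ uses (dag-n12-c g35 probe-2 census `UsedConstsN12RoadTyped2`, THEOREMS block), re-typed over a
BOND-LEVEL datum `𝔅 : BDetSet` (F0a `B15DeterminingSetsB`) and dag-n12-c's bond-datum chart `Node00.msChartB` (✓p774329; `msChart 𝐁 = msChartB (bondsDet 𝐁)` by `rfl`).  GENERATOR twin
(this seat's `work/g32/gen_thm.py`, block-extracted from the parent's tree bytes): namespace `…N12RootTransporterBjB`, SAME short names, `DetSet ↦ BDetSet`, `AgreeOn 𝐁 ↦ AgreeOnB 𝔅`,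
`IsMinimizer ↦ IsMinimizerB`, `bondsOf (𝐁 j) ↦ 𝔅 j`, `msChart ∕ constrCard ∕ constrEnum ∕ ConstrSet ↦ …B`, NODE 00 chart lemmas `…msChart… ↦ …msChartB…`; proofs VERBATIM; the parent's
datum-free declarations REUSED BY NAME (`open`), never copied (private plumbing excepted, №366 R2).  The parent's (b) statements are the instances `𝔅 := bondsDet 𝐁`.

Cell `pub-ymgap` (HUMAN RULINGS D-0062 ∕ D-0149), seat `pub-ymgap-dag-n12-d` g32 (R134 N12 [B15] s2; the (ii) Theorems-side re-key of N12's road at print's [II] (2.3) datum — director-ym №338 ∕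
№343 (E1)(iii-b), FLAG №16 ∕ ruling (α); dag-n12-c DESIGN memo a793b2ebc0b803bf (ii); `N12-ROAD-TWIN-ORDER-2026-08-30.md`).  Count-neutral helper of K1⁹ `stmt-QuantumFields-27364`,
`--kind proof --supports … --as helper`.  THEOREMS ONLY (0 `def`, 0 `instance`, 0 `sorry`).

HONEST FRAMING (director-ym №338 (5)).  PURELY ADDITIVE: the parent stays landed and true on its own text; nothing in it is edited; no displayed premise of any consumer is deleted or
weakened; every hypothesis of the parent stays a hypothesis.  Nothing of Bałaban's analysis asserted; N12 NOT discharged; K0⁷ ∕ K1⁹ NOT closed; counts unmoved (typed 28∕28 · discharged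
8∕27, A 8∕28; K 1∕4); one finite 𝕋⁴ programme at fixed ε — R4 closes the conditional rung `BalabanLadder.UV` only; NOT the Yang–Mills mass gap (Clay); nothing continuum ∕ ℝ⁴ ∕ OS.

PARENT's DOCSTRING (the mathematics and the citations; read the site-level `𝐁` as the bond datum `𝔅`):
# BalabanUVNodes ∕ N12 — THE ROOT-TRANSPORTER LETTER `hT` AT THE RECORD's `𝐁_k(Z)`, inhabited from the (G-c) root chains: for every fine bond inside `Ω₁(Z)` a fine word from `root b₋` to
# `root b₊` of length `≤ m·L^k` whose `U₀`-transport is within `m·θ_k` of a group element within `m·δ₁` of `1`, `m = 3·d·(L−1)∕2 + 5` — modulo dag-n12-w2's segment corr-factor letter and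
# the member-average letter (the second layer of dag-n12-w6's `B15Prop1InteriorLetterCorridor`, [Balaban1985Variational] (16)–(18) between the points of `𝔅_k`)

Cell `pub-ymgap` (HUMAN RULINGS D-0062 ∕ D-0149), WIDTH SEAT `pub-ymgap-dag-n12-w3` g4 (node N12 = [B15]; key K1⁹ `stmt-QuantumFields-27364` (KEY MAP v2), `--kind proof --supports … --as
helper`; count-neutral).  THEOREMS ONLY (0 `def`, 0 `instance`, 0 `sorry`); consumed BY NAME: this lineage's `N12BjRootChains.exists_rootChain_Bj` ∕ `exists_chain_root_centre` ∕
`exists_chain_centre_centre` and `N12BlockChains.length_flatten_le_of_forall_le`, dag-n12-w6's `T4ForestGaugeCorridorBound.dist1_holAt_chain_mul_prod_inv_le` ∕ `dist1_prod_le_sum` ∕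
`dist1_segRev_mul_iter_blockAvg_le` (p628442 ∕ p630939), dag-n12-w2's `BlockAveragingTowerStraightTransportLocal.dist1_straight_mul_inv_iter_le_local` (p627202).

WHY.  dag-n12-w6's `B15Prop1InteriorLetterCorridor` (first layer) reduces the corridor half `hL_corridor` of the interior letter of the localised gauge letter (σ)_N to a ROOT-TRANSPORTER
LETTER `hT : ∀ b, b₋ ∈ Ω₁ → b₊ ∈ Ω₁ → root b₋ ≠ root b₊ → ∃ Ω g, walkEnd (root b₋) Ω = root b₊ ∧ |Ω| ≤ ℓT ∧ dist1 (𝒰_{U₀}(walk (root b₋) Ω)·g⁻¹) ≤ eT ∧ dist1 g ≤ dG`.  THIS FILE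
inhabits `hT` at the record's `𝐁_k(Z)` — capped (`rootTransporter_Bj`, budgets at level `k`) and GRADED by the level of the bond (`rootTransporter_Bj_graded`, budgets at level `J + 1`) — (and the hub letters (H1)∕(H2) of `T4RootTransporterHubs`, hub = centre of the `Γ`-level block): the word is the concatenation of the straight segments
of a ROOT CHAIN of member bonds (`N12BjRootChains`), `g` the ordered product of the block averages `M^{i}(U₀)(c)^{±1}` along it, the transport error the sum of dag-n12-w2's `θ_i` per
link (forward `dist1_straight_mul_inv_iter_le_local`, backward `dist1_segRev_mul_iter_blockAvg_le`), `dist1 g ≤ Σ dist1 M(c)`.  DISPLAYED (hypotheses, dag-n12-w2's currency VERBATIM):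
the segment corr-factor letter `hκ` (the correction factors of [Balaban1987RG1] (0.4) met on the segment of every member bond, `κ_i + L·θ_i ≤ θ_{i+1}`, `0 ≤ θ_0`, `θ_i ≤ θ_k`) and the
member-average letter `dist1 (M^i(U₀)(c)) ≤ δ₁` on the members of `𝐁_k(Z)` (at the constrained minimiser: the datum side, `B15Prop1MinimiserTowerAxialGauge` §5).

HONEST FRAMING.  Lattice∕group bookkeeping by name; no estimate of Bałaban's asserted; the two letters, the forest and the minimiser stay DISPLAYED; N12 NOT discharged; K1⁹ NOT closed;
counts unmoved (typed 28∕28 · discharged 5∕27); one finite 𝕋⁴ programme at fixed ε — R4 closes the conditional rung `BalabanLadder.UV` only; the Yang–Mills mass gap (Clay) is NOT proved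
by any of this; nothing continuum ∕ ℝ⁴ ∕ OS.
-/

noncomputable section

namespace Summit.QuantumFields.YangMills.BalabanUVNodes.N12RootTransporterBjB

open Literature.MathematicalPhysics.QuantumFieldTheory.Balaban1983to89.B15DeterminingSetsB

open scoped BigOperators
open Literature.MathematicalPhysics.QuantumFieldTheory.Balaban1983to89
open T4Continuum BlockAveraging
open B15DeterminingSets
open B5Eq118OneStroke (iterBlockOf)
open B14.Eq213MaximalDomains (side)
open B14.Eq213DetSet (Bj Bj_zero maxDomT)
open T4ForestGaugeCorridorBound (dist1_holAt_chain_mul_prod_inv_le dist1_prod_le_sum dist1_segRev_mul_iter_blockAvg_le)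
open BlockAveragingTowerStraightTransportLocal (dist1_straight_mul_inv_iter_le_local)
open Summit.QuantumFields.YangMills.BalabanUVNodes.N12FlatHndRecordLetters (hcov_Bj)
open Summit.QuantumFields.YangMills.BalabanUVNodes.N12BlockChains (length_flatten_le_of_forall_le)
open Summit.QuantumFields.YangMills.BalabanUVNodes.N12BjRootChains (exists_rootChain_Bj exists_chain_root_centre exists_chain_centre_centre)
open Summit.QuantumFields.YangMills.BalabanUVNodes.N12BjRootChainsGraded (exists_rootChain_Bj_graded)

section
variable {P : Params} {G : Type*} [GaugeGroup G]

/-- ★★ **A CHAIN OF MEMBER LINKS IS A TRANSPORTER DATUM.**  `ℰ` any small-loop average, `U` a fine configuration, `𝔅` a determining set; dag-n12-w2's tower budgets `κ`, `θ` (`0 ≤ θ₀`,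
`κ_i + L·θ_i ≤ θ_{i+1}`, `θ_i ≤ θ_N` for `i ≤ N`, `N` a LEVEL CAP of the links); DISPLAYED: the segment corr-factor letter on every member bond of level `≤ k` (the hypothesis `hκ` of
`BlockAveragingTowerStraightTransportLocal.dist1_straight_mul_inv_iter_le_local`, verbatim) and the member-average letter `dist1 (M^i(U)(c)) ≤ δ₁`.  THEN a list of links `⟨i, c, ±⟩`, members
of level `≤ k`, whose segment words are consecutive from `r` (the `pre ++ l :: post` addressing), has: the transport of `U` along the concatenated segments within `(#links)·θ_k` of the
ordered product `g` of the `M^{i}(U)(c)^{±1}` (`θ_N` for the cap `N`), `dist1 g ≤ (#links)·δ₁`, and total length `≤ (#links)·L^N`.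
[cite: Balaban1985Variational, (16)–(18) p.280; Balaban1985Averaging, (19)–(20) p.21; Balaban1987RG1, (0.4) p.253] -/
theorem transporter_of_links (ℰ : LoopAverage G) (U : GaugeField P 0 G) (κ θ : ℕ → ℝ) (hθ0 : 0 ≤ θ 0) (hθ : ∀ i, κ i + P.L * θ i ≤ θ (i + 1))
    {k N : ℕ} (hθN : ∀ i ≤ N, θ i ≤ θ N) (𝔅 : BDetSet P)
    (hκ : ∀ i ≤ k, ∀ c ∈ (𝔅 i), ∀ i' < i, ∀ c' : PBond P (i' + 1), c'.dir = c.dir →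
      (∃ t < P.L ^ i, embIter (i' + 1) c'.src = (fun z : Site P 0 => z.shift c.dir)^[t] (embIter i c.src)) →
      dist1 (corr ℰ (Averaging.iter (fun i => blockAvg (P := P) (j := i) ℰ) i' U) c') ≤ κ i')
    {δ₁ : ℝ} (hδ₁ : ∀ i ≤ k, ∀ c ∈ (𝔅 i), dist1 (Averaging.iter (fun i => blockAvg (P := P) (j := i) ℰ) i U c) ≤ δ₁)
    (r : Site P 0) (links : List ((m : ℕ) × (PBond P m × Bool)))
    (hmem : ∀ l ∈ links, l.1 ≤ k ∧ l.2.1 ∈ (𝔅 l.1)) (hmemN : ∀ l ∈ links, l.1 ≤ N)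
    (hcons : ∀ (pre post : List ((m : ℕ) × (PBond P m × Bool))) (l : (m : ℕ) × (PBond P m × Bool)), links = pre ++ l :: post →
      (l.2.2 = true → walkEnd r (pre.map fun l => List.replicate (P.L ^ l.1) (l.2.1.dir, l.2.2)).flatten = embIter l.1 l.2.1.src) ∧
      (l.2.2 = false → walkEnd r (pre.map fun l => List.replicate (P.L ^ l.1) (l.2.1.dir, l.2.2)).flatten = embIter l.1 l.2.1.tgt)) :
    ∃ g : G, dist1 (holAt U (walk r (links.map fun l => List.replicate (P.L ^ l.1) (l.2.1.dir, l.2.2)).flatten) * g⁻¹) ≤ links.length * θ N ∧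
      dist1 g ≤ links.length * δ₁ ∧
      ((links.map fun l => List.replicate (P.L ^ l.1) (l.2.1.dir, l.2.2)).flatten).length ≤ links.length * P.L ^ N := by
  classical
  -- the links as (word, element, budget) triples
  set M : (m : ℕ) × (PBond P m × Bool) → G := fun l => Averaging.iter (fun i => blockAvg (P := P) (j := i) ℰ) l.1 U l.2.1 with hM
  set τ : (m : ℕ) × (PBond P m × Bool) → List (Letter P.d) × G × ℝ :=
    fun l => (List.replicate (P.L ^ l.1) (l.2.1.dir, l.2.2), (if l.2.2 then M l else (M l)⁻¹), θ l.1) with hτ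
  have hfst : (links.map τ).map Prod.fst = links.map fun l => List.replicate (P.L ^ l.1) (l.2.1.dir, l.2.2) := by
    rw [List.map_map]; rfl
  -- the per-link transporter letter
  have hlinks : ∀ (pre post : List (List (Letter P.d) × G × ℝ)) (link : List (Letter P.d) × G × ℝ), links.map τ = pre ++ link :: post →
      dist1 (holAt U (walk (walkEnd r (pre.map Prod.fst).flatten) link.1) * (link.2.1)⁻¹) ≤ link.2.2 := by
    intro pre post link h
    obtain ⟨pre₀, rest, hsplit, hpre, hrest⟩ := List.map_eq_append_iff.mp h
    obtain ⟨l₀, post₀, hrest', hl, -⟩ := List.map_eq_cons_iff.mp hrest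
    subst hl
    rw [hrest'] at hsplit
    obtain ⟨hl₀k, hl₀mem⟩ := hmem l₀ (by rw [hsplit]; simp)
    have hpre' : (pre.map Prod.fst).flatten = (pre₀.map fun l => List.replicate (P.L ^ l.1) (l.2.1.dir, l.2.2)).flatten := by
      rw [← hpre, List.map_map]; rfl
    have hst := hcons pre₀ post₀ l₀ hsplit
    have hκ₀ := hκ l₀.1 hl₀k l₀.2.1 hl₀mem
    rw [hpre']
    cases h2 : l₀.2.2
    · -- backward: from `ι c₊` along `(−e_dir)^{L^i}` versus `M(c)⁻¹`
      rw [hst.2 h2]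
      have hseg : (τ l₀).1 = wordRev (List.replicate (P.L ^ l₀.1) (l₀.2.1.dir, true)) := by
        show List.replicate (P.L ^ l₀.1) (l₀.2.1.dir, l₀.2.2) = _
        unfold wordRev
        rw [List.map_replicate, List.reverse_replicate, h2]
        rfl
      have hg : (τ l₀).2.1 = (M l₀)⁻¹ := by show (if l₀.2.2 then M l₀ else (M l₀)⁻¹) = _; rw [h2]; rfl
      rw [hseg, hg]
      exact dist1_segRev_mul_iter_blockAvg_le ℰ U κ θ hθ0 hθ l₀.1 l₀.2.1 hκ₀
    · -- forward: from `ι c₋` along `(+e_dir)^{L^i}` versus `M(c)`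
      rw [hst.1 h2]
      have hseg : (τ l₀).1 = List.replicate (P.L ^ l₀.1) (l₀.2.1.dir, true) := by
        show List.replicate (P.L ^ l₀.1) (l₀.2.1.dir, l₀.2.2) = _; rw [h2]
      have hg : (τ l₀).2.1 = M l₀ := by show (if l₀.2.2 then M l₀ else (M l₀)⁻¹) = _; rw [h2]; rfl
      rw [hseg, hg]
      exact dist1_straight_mul_inv_iter_le_local ℰ U κ θ hθ0 hθ l₀.1 l₀.2.1 hκ₀
  have hchain := dist1_holAt_chain_mul_prod_inv_le U (links.map τ) r hlinks
  rw [hfst] at hchain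
  refine ⟨((links.map τ).map fun l => l.2.1).prod, hchain.trans ?_, (dist1_prod_le_sum _).trans ?_, ?_⟩
  · -- `Σ θ_{i_l} ≤ (#links)·θ_N`
    have h : ∀ x ∈ (links.map τ).map (fun l => l.2.2), x ≤ θ N := by
      intro x hx
      obtain ⟨l, hl, rfl⟩ := List.mem_map.mp hx
      obtain ⟨l₀, hl₀, rfl⟩ := List.mem_map.mp hl
      exact hθN l₀.1 (hmemN l₀ hl₀)
    have := List.sum_le_card_nsmul _ (θ N) h
    rw [List.length_map, List.length_map, nsmul_eq_mul] at this
    exact this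
  · -- `Σ dist1 g_l ≤ (#links)·δ₁`
    have h : ∀ x ∈ ((links.map τ).map fun l => l.2.1).map dist1, x ≤ δ₁ := by
      intro x hx
      obtain ⟨g, hg, rfl⟩ := List.mem_map.mp hx
      obtain ⟨l, hl, rfl⟩ := List.mem_map.mp hg
      obtain ⟨l₀, hl₀, rfl⟩ := List.mem_map.mp hl
      have hd := hδ₁ l₀.1 (hmem l₀ hl₀).1 l₀.2.1 (hmem l₀ hl₀).2
      show dist1 (if l₀.2.2 then M l₀ else (M l₀)⁻¹) ≤ δ₁
      split_ifs
      · exact hd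
      · rw [GaugeGroup.dist1_inv]; exact hd
    have := List.sum_le_card_nsmul _ δ₁ h
    rw [List.length_map, List.length_map, List.length_map, nsmul_eq_mul] at this
    exact this
  · -- total length
    refine length_flatten_le_of_forall_le _ links fun l hl => ?_
    rw [List.length_replicate]
    exact Nat.pow_le_pow_right P.L_pos (hmemN l hl)

end

end Summit.QuantumFields.YangMills.BalabanUVNodes.N12RootTransporterBjB

end
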